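import Literature.Topology.FourManifolds.DiscBoundaryDiffeo
import Literature.Topology.FourManifolds.EuclideanAmbientIsotopy
import Literature.Topology.FourManifolds.PiecePar
import Literature.Topology.FourManifolds.ImmersionCriterion
import HarnessLib

/-!
# Realising the boundary diffeotopy of an orientation-preserving germ of the closed disc by a
# self-isotopy of the disc (second step of: `Diff⁺(D²)` is connected, in ambient-germ form)

Topic `Literature/Topology/FourManifolds` (programme of the fact
`Literature.Topology.FourManifolds.cerf_pi0DiffDisc_relBoundary_three`, brick C3a).  Let `d` be an embedding germ along the closed unit
disc `𝔻²` with `d '' 𝔻² = 𝔻²` and positive Jacobian (`DiscBoundaryDiffeo`): its boundary map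
is the end of a circle diffeotopy `F` (`exists_circle_ambientIsotopy`).  Here `F` is realised
ambiently: the isotopy `t ↦ incl ∘ F_t` of the unit circle in the plane extends to an ambient
isotopy `Θ` of `ℝ²` (`EuclideanAmbientIsotopy.exists_ambientIsotopy_comp_eq_euclidean`), whose
stages preserve the circle, hence the open and the closed unit disc; read as a plain family of
maps of `ℝ²` it is a self-isotopy of `𝔻²` in the sense of `PiecePar.IsSelfIsotopy`
(`exists_selfIsotopy_boundary`), ending at a stage `Θ₁` with `Θ₁ = d` on the circle.
Consequently `Θ₁⁻¹ ∘ d` is an embedding germ of `𝔻²` onto itself fixing the circle pointwise,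
in the same class as `d` — the input of the collar normalisation (third step).

## References
* [HirschDT1976] M. W. Hirsch, *Differential Topology*, GTM 33 (1976), Ch. 8 §1, Thm. 1.3 and
  §3, Thm. 3.3.
* [CerfDiffeoSphere1968] J. Cerf, LNM 53 (1968), Ch. IV §3, Propriété 3.
-/

noncomputable section

open Set Function Filter Topology Metric
open scoped ContDiff Manifold

namespace Literature.Topology.FourManifolds

/-- Local notation: `𝔼 n` is the model Euclidean space `EuclideanSpace ℝ (Fin n)`. -/
local notation "𝔼 " n:arg => EuclideanSpace ℝ (Fin n)
/-- Local notation: `𝕊 n` is the unit sphere in `EuclideanSpace ℝ (Fin (n + 1))`. -/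
local notation "𝕊 " n:arg => (Metric.sphere (0 : EuclideanSpace ℝ (Fin (n + 1))) 1)
/-- Local notation: `𝔻 n` is the closed unit ball in `EuclideanSpace ℝ (Fin n)`. -/
local notation "𝔻 " n:arg => (Metric.closedBall (0 : EuclideanSpace ℝ (Fin n)) 1)

attribute [local instance] fact_finrank_euclideanSpace_succ

/-! ### Ambient isotopies of `ℝᵏ⁺¹` read as plain families of maps -/

namespace AmbientIsotopy

variable {k : ℕ} (Θ : AmbientIsotopy (𝓡 (k + 1)) (𝔼 (k + 1)))

-- Joint smoothness of the family `uncurry Θ.toFun` in the vector-space sense is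
-- `AmbientIsotopy.contDiff_uncurry_toFun` (AmbientIsotopyLevelSuspension.lean).

/-- The inverse of a stage of an ambient isotopy of `ℝᵏ⁺¹` is smooth. [folklore] -/
theorem contDiff_stage_symm_euclidean (t : ℝ) : ContDiff ℝ ∞ (Θ.toDiffeomorph t).symm := by
  have h := (Θ.toDiffeomorph t).symm.contMDiff
  rw [contMDiff_iff_contDiff] at h
  exact h

/-- **The derivative of a stage of an ambient isotopy of `ℝᵏ⁺¹` is invertible everywhere**
(chain rule on the two-sided inverse). [folklore] -/
theorem isInvertible_fderiv_stage (t : ℝ) (x : 𝔼 (k + 1)) :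
    (fderiv ℝ (Θ.toFun t) x).IsInvertible := by
  set θ := Θ.toDiffeomorph t with hθ
  have hf : Differentiable ℝ (Θ.toFun t) := (Θ.contDiff_toFun t).differentiable (by simp)
  have hg : Differentiable ℝ θ.symm := (Θ.contDiff_stage_symm_euclidean t).differentiable (by simp)
  have hθf : ∀ y, θ y = Θ.toFun t y := fun y => by rw [hθ, AmbientIsotopy.coe_toDiffeomorph]
  have h1 : (fderiv ℝ θ.symm (Θ.toFun t x)).comp (fderiv ℝ (Θ.toFun t) x) =
      ContinuousLinearMap.id ℝ _ := by
    rw [← fderiv_comp x (hg _) (hf x)]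
    have : (θ.symm ∘ Θ.toFun t) = id := by
      funext y; simp only [comp_apply, ← hθf, Diffeomorph.symm_apply_apply, id_eq]
    rw [this, fderiv_id]
  have h2 : (fderiv ℝ (Θ.toFun t) x).comp (fderiv ℝ θ.symm (Θ.toFun t x)) =
      ContinuousLinearMap.id ℝ _ := by
    have hx : θ.symm (Θ.toFun t x) = x := by rw [← hθf, Diffeomorph.symm_apply_apply]
    have hcomp := fderiv_comp (Θ.toFun t x) (hf (θ.symm (Θ.toFun t x))) (hg (Θ.toFun t x))
    rw [hx] at hcomp
    rw [← hcomp]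
    have : (Θ.toFun t ∘ θ.symm) = id := by
      funext y; simp only [comp_apply, ← hθf, Diffeomorph.apply_symm_apply, id_eq]
    rw [this, fderiv_id]
  refine ⟨ContinuousLinearEquiv.equivOfInverse (fderiv ℝ (Θ.toFun t) x)
    (fderiv ℝ θ.symm (Θ.toFun t x)) (fun v => ?_) (fun w => ?_), rfl⟩
  · have := congrArg (fun L : 𝔼 (k + 1) →L[ℝ] 𝔼 (k + 1) => L v) h1
    simpa using this
  · have := congrArg (fun L : 𝔼 (k + 1) →L[ℝ] 𝔼 (k + 1) => L w) h2
    simpa using this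

/-- The Jacobian determinant of a stage at a point is continuous in the time. [folklore] -/
theorem continuous_det_fderiv_stage (x : 𝔼 (k + 1)) :
    Continuous fun s : ℝ => (fderiv ℝ (Θ.toFun s) x).det := by
  have hF := Θ.contDiff_uncurry_toFun
  have h1 : Continuous fun s : ℝ => fderiv ℝ (uncurry Θ.toFun) (s, x) :=
    (hF.continuous_fderiv (by simp)).comp (continuous_id.prodMk continuous_const)
  have h2 : ∀ s, fderiv ℝ (Θ.toFun s) x =
      (fderiv ℝ (uncurry Θ.toFun) (s, x)).comp (ContinuousLinearMap.inr ℝ ℝ (𝔼 (k + 1))) := by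
    intro s
    have hd : HasFDerivAt (uncurry Θ.toFun) (fderiv ℝ (uncurry Θ.toFun) (s, x))
        ((fun y : 𝔼 (k + 1) => ((s, y) : ℝ × 𝔼 (k + 1))) x) :=
      (hF.differentiable (by simp) _).hasFDerivAt
    have hι : HasFDerivAt (fun y : 𝔼 (k + 1) => ((s, y) : ℝ × 𝔼 (k + 1)))
        (ContinuousLinearMap.inr ℝ ℝ (𝔼 (k + 1))) x :=
      (hasFDerivAt_const s x).prodMk (hasFDerivAt_id x)
    exact (hd.comp x hι).fderiv
  have h3 : Continuous fun s : ℝ => fderiv ℝ (Θ.toFun s) x := by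
    have : (fun s : ℝ => fderiv ℝ (Θ.toFun s) x) = fun s =>
        (fderiv ℝ (uncurry Θ.toFun) (s, x)).comp (ContinuousLinearMap.inr ℝ ℝ (𝔼 (k + 1))) :=
      funext h2
    rw [this]
    exact h1.clm_comp continuous_const
  exact ContinuousLinearMap.continuous_det.comp h3

/-- An invertible continuous linear map has non-zero determinant. [folklore] -/
theorem det_ne_zero_of_isInvertible {L : 𝔼 (k + 1) →L[ℝ] 𝔼 (k + 1)} (hL : L.IsInvertible) :
    L.det ≠ 0 := by
  obtain ⟨e, rfl⟩ := hL
  intro h0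
  have h1 : LinearMap.det (((e.symm : 𝔼 (k + 1) ≃L[ℝ] 𝔼 (k + 1)) : 𝔼 (k + 1) →L[ℝ] 𝔼 (k + 1)) :
      𝔼 (k + 1) →ₗ[ℝ] 𝔼 (k + 1)) *
      LinearMap.det (((e : 𝔼 (k + 1) ≃L[ℝ] 𝔼 (k + 1)) : 𝔼 (k + 1) →L[ℝ] 𝔼 (k + 1)) :
      𝔼 (k + 1) →ₗ[ℝ] 𝔼 (k + 1)) = 1 := by
    rw [← LinearMap.det_comp]
    have : (((e.symm : 𝔼 (k + 1) ≃L[ℝ] 𝔼 (k + 1)) : 𝔼 (k + 1) →L[ℝ] 𝔼 (k + 1)) :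
        𝔼 (k + 1) →ₗ[ℝ] 𝔼 (k + 1)).comp
        (((e : 𝔼 (k + 1) ≃L[ℝ] 𝔼 (k + 1)) : 𝔼 (k + 1) →L[ℝ] 𝔼 (k + 1)) :
        𝔼 (k + 1) →ₗ[ℝ] 𝔼 (k + 1)) = LinearMap.id := by
      ext v; simp
    rw [this, LinearMap.det_id]
  have h0' : LinearMap.det (((e : 𝔼 (k + 1) ≃L[ℝ] 𝔼 (k + 1)) : 𝔼 (k + 1) →L[ℝ] 𝔼 (k + 1)) :
      𝔼 (k + 1) →ₗ[ℝ] 𝔼 (k + 1)) = 0 := h0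
  rw [h0', mul_zero] at h1
  exact zero_ne_one h1

/-- **Positive Jacobian**: the stages of an ambient isotopy of `ℝᵏ⁺¹` have positive Jacobian
determinant (it is continuous in the time, never zero, and `1` at time `0`). [folklore] -/
theorem det_fderiv_stage_pos (t : ℝ) (x : 𝔼 (k + 1)) :
    0 < LinearMap.det (fderiv ℝ (Θ.toFun t) x : 𝔼 (k + 1) →ₗ[ℝ] 𝔼 (k + 1)) := by
  have hcont := Θ.continuous_det_fderiv_stage x
  have hne : ∀ s, (fderiv ℝ (Θ.toFun s) x).det ≠ 0 := fun s =>
    det_ne_zero_of_isInvertible (Θ.isInvertible_fderiv_stage s x)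
  have h0 : (fderiv ℝ (Θ.toFun 0) x).det = 1 := by
    rw [Θ.map_zero, fderiv_id]
    exact LinearMap.det_id
  show 0 < (fderiv ℝ (Θ.toFun t) x).det
  rcases lt_or_gt_of_ne (hne t) with hlt | hgt
  · exfalso
    -- intermediate value between `det = 1` at `0` and `det < 0` at `t`
    have hmem : (0 : ℝ) ∈ uIcc ((fun s => (fderiv ℝ (Θ.toFun s) x).det) 0)
        ((fun s => (fderiv ℝ (Θ.toFun s) x).det) t) := by
      simp only [h0]
      exact mem_uIcc.2 (Or.inr ⟨hlt.le, zero_le_one⟩)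
    obtain ⟨s, -, hs⟩ := intermediate_value_uIcc hcont.continuousOn hmem
    exact hne s hs
  · exact hgt

/-- The stages of an ambient isotopy of `ℝᵏ⁺¹` are embedding germs along every set.
[folklore] -/
theorem isEmbGerm_stage (K : Set (𝔼 (k + 1))) (t : ℝ) : IsEmbGerm K (Θ.toFun t) :=
  ⟨Θ.contDiff_toFun t, fun x _ => Θ.isInvertible_fderiv_stage t x,
    (Θ.bijective t).injective.injOn⟩

/-! ### Ambient isotopies of the plane which move the unit circle along a circle diffeotopy -/

/-- **Invariance of the unit disc.**  If the stages of an ambient isotopy of the plane map the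
unit circle onto itself for `t ∈ [0, 1]`, they map the open unit disc onto itself and the
exterior onto itself for these times: `s ↦ ‖Θ_s y‖ - 1` never vanishes off the circle, so it
keeps its sign. [folklore] -/
theorem norm_stage_lt_one {Θ : AmbientIsotopy (𝓡 2) (𝔼 2)}
    (hS : ∀ t ∈ Icc (0 : ℝ) 1, Θ.toFun t '' sphere (0 : 𝔼 2) 1 = sphere 0 1) {t : ℝ}
    (ht : t ∈ Icc (0 : ℝ) 1) {y : 𝔼 2} (hy : ‖y‖ < 1) : ‖Θ.toFun t y‖ < 1 := by
  by_contra hge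
  push Not at hge
  -- the continuous function `s ↦ ‖Θ_s y‖` takes the value `1` on `[0, t]`
  have hc : Continuous fun s : ℝ => ‖Θ.toFun s y‖ :=
    (Θ.contDiff_uncurry_toFun.continuous.comp (continuous_id.prodMk continuous_const)).norm
  have h0 : ‖Θ.toFun 0 y‖ = ‖y‖ := by rw [Θ.map_zero, id]
  have hmem : (1 : ℝ) ∈ Icc ((fun s => ‖Θ.toFun s y‖) 0) ((fun s => ‖Θ.toFun s y‖) t) := by
    simp only [h0]; exact ⟨hy.le, hge⟩
  obtain ⟨s, hs, hs1⟩ := intermediate_value_Icc ht.1 hc.continuousOn hmem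
  have hsI : s ∈ Icc (0 : ℝ) 1 := ⟨hs.1, hs.2.trans ht.2⟩
  -- so `Θ_s y ∈ S¹ = Θ_s '' S¹`, and `y ∈ S¹` by injectivity
  have hin : Θ.toFun s y ∈ Θ.toFun s '' sphere (0 : 𝔼 2) 1 := by
    rw [hS s hsI]; exact mem_sphere_zero_iff_norm.2 hs1
  obtain ⟨z, hz, hzy⟩ := hin
  have hyz : z = y := (Θ.bijective s).injective hzy
  rw [← hyz, mem_sphere_zero_iff_norm.1 hz] at hy
  exact lt_irrefl _ hy

/-- The same for the exterior of the unit disc. [folklore] -/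
theorem one_lt_norm_stage {Θ : AmbientIsotopy (𝓡 2) (𝔼 2)}
    (hS : ∀ t ∈ Icc (0 : ℝ) 1, Θ.toFun t '' sphere (0 : 𝔼 2) 1 = sphere 0 1) {t : ℝ}
    (ht : t ∈ Icc (0 : ℝ) 1) {y : 𝔼 2} (hy : 1 < ‖y‖) : 1 < ‖Θ.toFun t y‖ := by
  by_contra hle
  push Not at hle
  have hc : Continuous fun s : ℝ => ‖Θ.toFun s y‖ :=
    (Θ.contDiff_uncurry_toFun.continuous.comp (continuous_id.prodMk continuous_const)).norm
  have h0 : ‖Θ.toFun 0 y‖ = ‖y‖ := by rw [Θ.map_zero, id]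
  have hmem : (1 : ℝ) ∈ uIcc ((fun s => ‖Θ.toFun s y‖) 0) ((fun s => ‖Θ.toFun s y‖) t) := by
    simp only [h0]; exact mem_uIcc.2 (Or.inr ⟨hle, hy.le⟩)
  obtain ⟨s, hs, hs1⟩ := intermediate_value_uIcc hc.continuousOn hmem
  rw [uIcc_of_le ht.1] at hs
  have hsI : s ∈ Icc (0 : ℝ) 1 := ⟨hs.1, hs.2.trans ht.2⟩
  have hin : Θ.toFun s y ∈ Θ.toFun s '' sphere (0 : 𝔼 2) 1 := by
    rw [hS s hsI]; exact mem_sphere_zero_iff_norm.2 hs1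
  obtain ⟨z, hz, hzy⟩ := hin
  have hyz : z = y := (Θ.bijective s).injective hzy
  rw [← hyz, mem_sphere_zero_iff_norm.1 hz] at hy
  exact lt_irrefl _ hy

/-- **Stages preserving the unit circle preserve the closed unit disc.** [folklore] -/
theorem image_closedBall_eq {Θ : AmbientIsotopy (𝓡 2) (𝔼 2)}
    (hS : ∀ t ∈ Icc (0 : ℝ) 1, Θ.toFun t '' sphere (0 : 𝔼 2) 1 = sphere 0 1) {t : ℝ}
    (ht : t ∈ Icc (0 : ℝ) 1) : Θ.toFun t '' (𝔻 2) = 𝔻 2 := by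
  apply Subset.antisymm
  · rintro _ ⟨y, hy, rfl⟩
    rcases (mem_closedBall_zero_iff.1 hy).lt_or_eq with hlt | heq
    · exact mem_closedBall_zero_iff.2 (norm_stage_lt_one hS ht hlt).le
    · have : Θ.toFun t y ∈ Θ.toFun t '' sphere (0 : 𝔼 2) 1 :=
        mem_image_of_mem _ (mem_sphere_zero_iff_norm.2 heq)
      rw [hS t ht] at this
      exact sphere_subset_closedBall this
  · intro w hw
    obtain ⟨y, rfl⟩ := (Θ.bijective t).surjective w
    refine ⟨y, ?_, rfl⟩
    by_contra hy
    have hy' : 1 < ‖y‖ := not_le.1 fun h => hy (mem_closedBall_zero_iff.2 h)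
    have := one_lt_norm_stage hS ht hy'
    exact not_le.2 this (mem_closedBall_zero_iff.1 hw)

end AmbientIsotopy

/-! ### The circle isotopy extends to the plane -/

section CircleToPlane

/-- **A diffeotopy of the unit circle extends to an ambient isotopy of the plane.**  The smooth
isotopy `t ↦ incl ∘ F_t` of embeddings of `𝕊¹` in `ℝ²` (inclusion after a circle
diffeomorphism) is realised by an ambient isotopy `Θ` of `ℝ²`: `Θ_t z = F_t z` on the circle
for `t ∈ [0, 1]`. [cite: HirschDT1976, Ch. 8 §1, Thm. 1.3] -/
theorem exists_ambientIsotopy_plane_of_circle (F : AmbientIsotopy (𝓡 1) (𝕊 1)) :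
    ∃ Θ : AmbientIsotopy (𝓡 2) (𝔼 2), ∀ t ∈ Icc (0 : ℝ) 1, ∀ z : 𝕊 1,
      Θ.toFun t z = ((F.toFun t z : 𝕊 1) : 𝔼 2) := by
  -- the isotopy of embeddings `incl ∘ F_t`
  have hemb : ∀ t, Manifold.IsSmoothEmbedding (𝓡 1) (𝓡 2) ∞
      (fun z : 𝕊 1 => ((F.toFun t z : 𝕊 1) : 𝔼 2)) := by
    intro t
    have hsm : ContMDiff (𝓡 1) (𝓡 2) ∞ (fun z : 𝕊 1 => ((F.toFun t z : 𝕊 1) : 𝔼 2)) :=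
      contMDiff_coe_sphere.comp (F.contMDiff_toFun t)
    refine isSmoothEmbedding_of_injective_of_injective_mfderiv hsm (by simp)
      (Subtype.val_injective.comp (F.bijective t).injective) fun z => ?_
    have h1 : MDifferentiableAt (𝓡 1) (𝓡 2) (fun w : 𝕊 1 => ((w : 𝕊 1) : 𝔼 2)) (F.toFun t z) :=
      ((contMDiff_coe_sphere (E := 𝔼 2) (n := 1)) (F.toFun t z)).mdifferentiableAt one_ne_zero
    have h2 : MDifferentiableAt (𝓡 1) (𝓡 1) (F.toFun t) z :=
      ((F.contMDiff_toFun t) z).mdifferentiableAt (by simp)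
    rw [show (fun z : 𝕊 1 => ((F.toFun t z : 𝕊 1) : 𝔼 2)) =
      (fun w : 𝕊 1 => ((w : 𝕊 1) : 𝔼 2)) ∘ F.toFun t from rfl, mfderiv_comp z h1 h2]
    have hinj2 : Injective (mfderiv (𝓡 1) (𝓡 1) (F.toFun t) z) := by
      have h := (F.isLocalDiffeomorph t).mfderivToContinuousLinearEquiv_coe (by simp) z
      rw [← h]
      exact ((F.isLocalDiffeomorph t).mfderivToContinuousLinearEquiv (by simp) z).injective
    exact (mfderiv_coe_sphere_injective (n := 1) (F.toFun t z)).comp hinj2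
  obtain ⟨G, hG⟩ : ∃ G : SmoothIsotopy (𝓡 1) (𝓡 2) (fun z : 𝕊 1 => ((z : 𝕊 1) : 𝔼 2))
      (fun z : 𝕊 1 => ((F.toFun 1 z : 𝕊 1) : 𝔼 2)),
      ∀ t, G.toFun t = fun z : 𝕊 1 => ((F.toFun t z : 𝕊 1) : 𝔼 2) :=
    ⟨{ toFun := fun t z => ((F.toFun t z : 𝕊 1) : 𝔼 2)
       contMDiff := contMDiff_coe_sphere.comp F.contMDiff
       isSmoothEmbedding := hemb
       map_zero := by funext z; simp [F.map_zero]
       map_one := rfl }, fun t => rfl⟩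
  obtain ⟨Θ, hΘ⟩ := exists_ambientIsotopy_comp_eq_euclidean G
  refine ⟨Θ, fun t ht z => ?_⟩
  have h := congrFun (hΘ t ht) z
  rw [hG t] at h
  exact h

end CircleToPlane

/-! ### The self-isotopy of the disc realising the boundary map -/

section Disc

variable {d : 𝔼 2 → 𝔼 2}

/-- **Second step of the connectedness of `Diff⁺(D²)`.**  For an orientation-preserving
embedding germ `d` of the closed unit disc onto itself there is a self-isotopy `Θ` of `𝔻²`
(in the sense of `IsSelfIsotopy`, indeed an ambient isotopy of the plane with bijective,
positive-Jacobian stages) whose end agrees with `d` on the unit circle.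
[cite: HirschDT1976, Ch. 8 §1 Thm. 1.3 and §3 Thm. 3.3] -/
theorem exists_selfIsotopy_boundary (hd : IsEmbGerm (𝔻 2) d) (himg : d '' (𝔻 2) = 𝔻 2)
    (hdet : ∀ x ∈ 𝔻 2, 0 < LinearMap.det (fderiv ℝ d x : 𝔼 2 →ₗ[ℝ] 𝔼 2)) :
    ∃ Θ : ℝ → 𝔼 2 → 𝔼 2, IsSelfIsotopy (𝔻 2) Θ ∧ (∀ t, Bijective (Θ t)) ∧
      (∀ t x, 0 < LinearMap.det (fderiv ℝ (Θ t) x : 𝔼 2 →ₗ[ℝ] 𝔼 2)) ∧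
      ∀ z ∈ sphere (0 : 𝔼 2) 1, Θ 1 z = d z := by
  obtain ⟨ψ, F, hψ, hF1⟩ := hd.exists_circle_ambientIsotopy himg hdet
  obtain ⟨Θ, hΘ⟩ := exists_ambientIsotopy_plane_of_circle F
  -- the stages map the circle onto itself
  have hS : ∀ t ∈ Icc (0 : ℝ) 1, Θ.toFun t '' sphere (0 : 𝔼 2) 1 = sphere 0 1 := by
    intro t ht
    apply Subset.antisymm
    · rintro _ ⟨z, hz, rfl⟩
      have h := hΘ t ht ⟨z, hz⟩
      simp only at h
      rw [h]; exact (F.toFun t ⟨z, hz⟩).2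
    · intro w hw
      obtain ⟨z, hz⟩ := (F.bijective t).surjective ⟨w, hw⟩
      refine ⟨z, z.2, ?_⟩
      rw [hΘ t ht z, hz]
  refine ⟨Θ.toFun, ⟨Θ.contDiff_uncurry_toFun, fun t _ => Θ.isEmbGerm_stage _ t,
    fun t ht => AmbientIsotopy.image_closedBall_eq hS ht, fun x _ => by rw [Θ.map_zero]; rfl⟩,
    Θ.bijective, Θ.det_fderiv_stage_pos, fun z hz => ?_⟩
  rw [hΘ 1 ⟨zero_le_one, le_rfl⟩ ⟨z, hz⟩, hF1]
  exact hψ ⟨z, hz⟩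


/-! ### Third step: reduction to a germ fixing the circle pointwise -/

/-- **Reduction to germs fixing the boundary pointwise.**  An orientation-preserving embedding
germ `d` of the closed unit disc onto itself factors as `d = Θ₁ ∘ d₁` on `𝔻²`, where `Θ` is a
self-isotopy of `𝔻²` (realising the boundary diffeotopy) and `d₁` is an orientation-preserving
embedding germ of `𝔻²` onto itself FIXING THE UNIT CIRCLE POINTWISE (`d₁ = Θ₁⁻¹ ∘ d`).
[cite: HirschDT1976, Ch. 8 §3, proof of Thm. 3.3] -/
theorem exists_factor_fixing_sphere (hd : IsEmbGerm (𝔻 2) d) (himg : d '' (𝔻 2) = 𝔻 2)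
    (hdet : ∀ x ∈ 𝔻 2, 0 < LinearMap.det (fderiv ℝ d x : 𝔼 2 →ₗ[ℝ] 𝔼 2)) :
    ∃ (Θ : ℝ → 𝔼 2 → 𝔼 2) (d₁ : 𝔼 2 → 𝔼 2), IsSelfIsotopy (𝔻 2) Θ ∧
      IsEmbGerm (𝔻 2) d₁ ∧ d₁ '' (𝔻 2) = 𝔻 2 ∧
      (∀ x ∈ 𝔻 2, 0 < LinearMap.det (fderiv ℝ d₁ x : 𝔼 2 →ₗ[ℝ] 𝔼 2)) ∧
      (∀ z ∈ sphere (0 : 𝔼 2) 1, d₁ z = z) ∧ (∀ x ∈ 𝔻 2, Θ 1 (d₁ x) = d x) := by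
  obtain ⟨Θ, hΘ, hbij, hΘdet, hΘ1⟩ := exists_selfIsotopy_boundary hd himg hdet
  obtain ⟨G, hG, hGΘ, hΘG⟩ := hΘ.exists_inverse (isCompact_closedBall 0 1)
  have h1 : (1 : ℝ) ∈ Icc (0 : ℝ) 1 := ⟨zero_le_one, le_rfl⟩
  have hG1 : IsEmbGerm (𝔻 2) (G 1) := hG.isEmbGerm 1 h1
  have hdD : ∀ x ∈ 𝔻 2, d x ∈ 𝔻 2 := fun x hx => by rw [← himg]; exact mem_image_of_mem d hx
  refine ⟨Θ, G 1 ∘ d, hΘ, ?_, ?_, fun x hx => ?_, fun z hz => ?_, fun x hx => ?_⟩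
  · exact (himg ▸ hG1).comp hd
  · rw [image_comp, himg, hG.image_eq 1 h1]
  · -- positive Jacobian: `det D(G₁)(d x) · det DΘ₁ (G₁ (d x)) = 1` and both `det DΘ₁`, `det Dd` are positive
    have hdx := hdD x hx
    have hdiffG : DifferentiableAt ℝ (G 1) (d x) := (hG.contDiff_stage 1).differentiable (by simp) _
    have hdiffd : DifferentiableAt ℝ d x := hd.contDiff.differentiable (by simp) x
    have hdiffΘ : DifferentiableAt ℝ (Θ 1) (G 1 (d x)) := (hΘ.contDiff_stage 1).differentiable (by simp) _
    -- `Θ₁ ∘ G₁ = id` near `d x`… we only need the derivative identity at the point, from the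
    -- germ identity `Θ₁ (G₁ y) = y` for `y` near `𝔻` applied through `fderiv` of the composite
    have hcompId : (fderiv ℝ (Θ 1) (G 1 (d x))).comp (fderiv ℝ (G 1) (d x)) =
        ContinuousLinearMap.id ℝ (𝔼 2) := by
      rw [← fderiv_comp (d x) hdiffΘ hdiffG]
      -- `Θ 1 ∘ G 1 = id` on a neighbourhood of `d x ∈ 𝔻`: use the image `G 1 '' 𝔻 = 𝔻` and the
      -- germ identity of `hGΘ`?  Simpler: `Θ 1 ∘ G 1 = id` on `𝔻` and both sides smooth; we use the
      -- neighbourhood form from the inverse-family construction through `IsoRel`-free facts: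
      -- `G 1` is injective near `𝔻` with `Θ 1 (G 1 y) = y` on `𝔻`; differentiate along `𝔻` via
      -- unique differentiability of the convex body `𝔻`.
      have hud : UniqueDiffWithinAt ℝ (𝔻 2) (d x) :=
        uniqueDiffOn_convex (convex_closedBall 0 1)
          (by rw [_root_.interior_closedBall _ one_ne_zero]; exact ⟨0, by simp⟩) (d x) hdx
      have hwithin : HasFDerivWithinAt (Θ 1 ∘ G 1)
          ((fderiv ℝ (Θ 1) (G 1 (d x))).comp (fderiv ℝ (G 1) (d x))) (𝔻 2) (d x) :=
        (hdiffΘ.hasFDerivAt.comp (d x) hdiffG.hasFDerivAt).hasFDerivWithinAt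
      have hwithin' : HasFDerivWithinAt (Θ 1 ∘ G 1) (ContinuousLinearMap.id ℝ (𝔼 2)) (𝔻 2) (d x) :=
        (hasFDerivWithinAt_id (d x) (𝔻 2)).congr (fun y hy => hΘG 1 h1 y hy) (hΘG 1 h1 _ hdx)
      rw [fderiv_comp (d x) hdiffΘ hdiffG]
      exact hud.eq hwithin hwithin'
    have hdetprod : LinearMap.det (fderiv ℝ (Θ 1) (G 1 (d x)) : 𝔼 2 →ₗ[ℝ] 𝔼 2) *
        LinearMap.det (fderiv ℝ (G 1) (d x) : 𝔼 2 →ₗ[ℝ] 𝔼 2) = 1 := by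
      rw [← LinearMap.det_comp,
        show (fderiv ℝ (Θ 1) (G 1 (d x)) : 𝔼 2 →ₗ[ℝ] 𝔼 2).comp (fderiv ℝ (G 1) (d x) : 𝔼 2 →ₗ[ℝ] 𝔼 2) =
          (((fderiv ℝ (Θ 1) (G 1 (d x))).comp (fderiv ℝ (G 1) (d x)) : 𝔼 2 →L[ℝ] 𝔼 2) :
            𝔼 2 →ₗ[ℝ] 𝔼 2) from rfl, hcompId]
      exact LinearMap.det_id
    have hGdet : 0 < LinearMap.det (fderiv ℝ (G 1) (d x) : 𝔼 2 →ₗ[ℝ] 𝔼 2) := by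
      have hpos := hΘdet 1 (G 1 (d x))
      by_contra hle
      push Not at hle
      have : LinearMap.det (fderiv ℝ (Θ 1) (G 1 (d x)) : 𝔼 2 →ₗ[ℝ] 𝔼 2) *
          LinearMap.det (fderiv ℝ (G 1) (d x) : 𝔼 2 →ₗ[ℝ] 𝔼 2) ≤ 0 :=
        mul_nonpos_of_nonneg_of_nonpos hpos.le hle
      linarith
    show 0 < LinearMap.det (fderiv ℝ (G 1 ∘ d) x : 𝔼 2 →ₗ[ℝ] 𝔼 2)
    rw [fderiv_comp x hdiffG hdiffd,
      show (((fderiv ℝ (G 1) (d x)).comp (fderiv ℝ d x) : 𝔼 2 →L[ℝ] 𝔼 2) : 𝔼 2 →ₗ[ℝ] 𝔼 2) =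
        (fderiv ℝ (G 1) (d x) : 𝔼 2 →ₗ[ℝ] 𝔼 2).comp (fderiv ℝ d x : 𝔼 2 →ₗ[ℝ] 𝔼 2) from rfl,
      LinearMap.det_comp]
    exact mul_pos hGdet (hdet x hx)
  · show G 1 (d z) = z
    rw [← hΘ1 z hz, hGΘ 1 h1 z (sphere_subset_closedBall hz)]
  · show Θ 1 (G 1 (d x)) = d x
    exact hΘG 1 h1 _ (hdD x hx)

end Disc



end Literature.Topology.FourManifolds
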